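import Literature.NumberTheory.Sieve.FriedlanderIwaniecPrimesJacobiTwistedLargeLevel
import Literature.NumberTheory.Sieve.FriedlanderIwaniecPrimesJacobiTwistedOffDiagonal
import Literature.NumberTheory.Sieve.FriedlanderIwaniecPrimesJacobiTwistedEqualDenominators
import Literature.NumberTheory.Sieve.FriedlanderIwaniecPrimesJacobiTwistedParameterChoice
import Literature.NumberTheory.Sieve.FriedlanderIwaniecPrimesSmoothMajorantMellinKernel
import Literature.NumberTheory.Sieve.FriedlanderIwaniecPrimesCutoffFourierKernel
import Literature.NumberTheory.Sieve.DivisorBound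
import HarnessLib

/-!
# Friedlander–Iwaniec, *The polynomial `X² + Y⁴` captures its primes*, §12: Proposition 12.1 —
# the regime `D < RS` of the flipped form

[FI, §12, p. 51 of arXiv:math/9811185 = Ann. of Math. (2) 148 (1998), 945–1040]: "Summing over `m`
and `c` we conclude that `V(D) ≪ {D + (DHRS)^{1/2}(log 2RS)⁴ + H⁻¹RS log 2RS + [D⁻¹(RS)^{3/2} + RS^{3/4}
 + SR^{3/4}](RS)^ε} ∑∑τ(r)|α_{rs}|²`.  We choose `H = (D⁻¹RS)^{1/3}` getting (12.4)."

This file PROVES that collection for the flipped form (`exists_jtVflip_le_of_lt`): with the majorant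
`F` (`exists_majorant_mellinKernel`), the cutoff `g` at `a = S/(HR)`, `b = S/R`
(`exists_cutoff_fourierKernel`), the smoothed excised inequality (`jtVflip_le_smooth_excised`), the
diagonal `r₁ = r₂` (`norm_sum_eqDenom_le`), the off-diagonal reduction and bound
(`exists_norm_offDiag_le'`), the re-indexing `r = ct` (`sum_Icc_sum_Ioc_div_le`) and the parameter
bookkeeping (`rpow_third_bookkeeping`, `log_bookkeeping`).  No definitions, no named facts
(HOME/parity-ideate-lit/FI98-Prop121-MAP.md, step D-h of the g26 addendum).

## References

* J. Friedlander, H. Iwaniec, *The polynomial `X² + Y⁴` captures its primes*, Ann. of Math. (2) 148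
  (1998), 945–1040, §12, Proposition 12.1, (12.4)–(12.17). [FriedlanderIwaniecAnnals1998]
-/

noncomputable section

open Finset Real Complex MeasureTheory
open scoped NumberTheorySymbols ArithmeticFunction.sigma ComplexConjugate

namespace Literature.NumberTheory.Sieve.FriedlanderIwaniecPrimes

set_option maxHeartbeats 1600000 in
/-- **Proposition 12.1, flipped form, regime `D < RS`** [FI, §12, (12.4)–(12.17)]: for every
`0 < ε ≤ 1` there is `C > 0` such that for `1 ≤ D < RS`, `R, S ≥ 1`, and `β` supported on
`(r, 2s) = 1` in one class modulo `4`,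
`∑_{D<d≤2D} ∑_{a mod d} |∑∑_{(r,d)=1, s ≡ a r (d)} β_{rs} (d/r)|²
   ≤ C {D + D^{1/3}(RS)^{2/3}(log 2RS)⁴ + [D⁻¹(RS)^{3/2} + RS^{3/4} + SR^{3/4}](RS)^{ε/2}} ∑∑ τ(r)|β_{rs}|²`.
[cite: FriedlanderIwaniecAnnals1998, §12, Proposition 12.1 / (12.4)] -/
theorem exists_jtVflip_le_of_lt {ε : ℝ} (hε : 0 < ε) (hε1 : ε ≤ 1) :
    ∃ C : ℝ, 0 < C ∧ ∀ (D R S : ℕ) (β : ℕ → ℕ → ℂ), 1 ≤ D → 1 ≤ R → 1 ≤ S → D < R * S →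
      (∀ r s, β r s ≠ 0 → r.Coprime (2 * s)) →
      (∀ r₁ s₁ r₂ s₂, β r₁ s₁ ≠ 0 → β r₂ s₂ ≠ 0 → r₁ % 4 = r₂ % 4) →
      ∑ d ∈ Ioc D (2 * D), ∑ a' ∈ range d, ‖∑ r ∈ Ioc R (2 * R), ∑ s ∈ Ioc S (2 * S),
          (if r.Coprime d ∧ (d : ℤ) ∣ (s : ℤ) - (a' : ℤ) * r then β r s * (J((d : ℤ) | r) : ℂ)
            else 0)‖ ^ 2 ≤
        C * ((D : ℝ) + (D : ℝ) ^ (1 / 3 : ℝ) * ((R : ℝ) * S) ^ (2 / 3 : ℝ) *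
              Real.log (2 * R * S) ^ 4 +
            ((D : ℝ)⁻¹ * ((R : ℝ) * S) ^ (3 / 2 : ℝ) + R * (S : ℝ) ^ (3 / 4 : ℝ) +
                S * (R : ℝ) ^ (3 / 4 : ℝ)) * ((R : ℝ) * S) ^ (ε / 2)) *
          ∑ r ∈ Ioc R (2 * R), ∑ s ∈ Ioc S (2 * S), (σ 0 r : ℝ) * ‖β r s‖ ^ 2 := by
  obtain ⟨F, M, -, hF0, hF1, hF2, hF3, hF4, hMc, hMi, hFM⟩ := exists_majorant_mellinKernel
  obtain ⟨K, hK, hcut⟩ := exists_cutoff_fourierKernel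
  have hε4 : 0 < ε / 4 := by positivity
  have hε41 : ε / 4 ≤ 1 := by linarith
  obtain ⟨Cₒ, hCₒ, hoff⟩ := exists_norm_offDiag_le' hε4 hε41
  obtain ⟨C₁, hC₁1, hC₁⟩ := Literature.NumberTheory.Sieve.exists_card_divisors_le_mul_rpow
    (ε := 1 / 2) (by norm_num)
  have hδ : 0 < ε / 20 := by positivity
  obtain ⟨C₂, hC₂1, hC₂⟩ := Literature.NumberTheory.Sieve.exists_card_divisors_le_mul_rpow hδ
  set IM : ℝ := ∫ t : ℝ, (1 + |t|) ^ 2 * ‖M t‖ with hIM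
  have hIM0 : 0 ≤ IM := by
    rw [hIM]; exact integral_nonneg fun t => mul_nonneg (by positivity) (norm_nonneg _)
  -- the constants of the three groups of terms
  set cN : ℝ := Cₒ * K * IM * C₁ * 3456 with hcN
  set cT : ℝ := Cₒ * K * IM * C₂ ^ 2 * (20 / ε) ^ 3 * 27648 with hcT
  set cE : ℝ := 3456 + 48 + 3 + 3 + 48 / ε with hcE
  have hcN0 : 0 ≤ cN := by rw [hcN]; positivity
  have hcT0 : 0 ≤ cT := by rw [hcT]; positivity
  have hcE0 : 0 ≤ cE := by rw [hcE]; positivity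
  clear_value cN cT cE IM
  refine ⟨cN + cT + cE + 1, by positivity, ?_⟩
  intro D R S β hD hR hS hlt hβ hβ4
  -- real parameters
  have hD0 : (0 : ℝ) < D := by exact_mod_cast hD
  have hR1 : (1 : ℝ) ≤ R := by exact_mod_cast hR
  have hS1 : (1 : ℝ) ≤ S := by exact_mod_cast hS
  have hD1 : (1 : ℝ) ≤ D := by exact_mod_cast hD
  have hR0 : (0 : ℝ) < R := by linarith
  have hS0 : (0 : ℝ) < S := by linarith
  have hDX' : (D : ℝ) < R * S := by exact_mod_cast hlt
  obtain ⟨hlog2, h12𝓛, hlog2R, hlogX0, hlogX, hlogS0, hlogS, hlogQ⟩ := log_bookkeeping hR1 hS1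
  set 𝓛 : ℝ := Real.log (2 * R * S) with h𝓛
  clear_value 𝓛
  have h𝓛0 : 0 < 𝓛 := by
    have : (0.6931471803 : ℝ) < Real.log 2 := Real.log_two_gt_d9
    linarith
  obtain ⟨hH1, hXH, hsqrt, hH2, hXHD, hlogH0, hlogH⟩ := rpow_third_bookkeeping hR1 hS1 hD1 hDX'
  generalize hHdef : ((R : ℝ) * S / D) ^ (1 / 3 : ℝ) = H at hH1 hXH hsqrt hH2 hXHD hlogH0 hlogH
  rw [← h𝓛] at hlogH
  have hH0 : 0 < H := by linarith
  set X : ℝ := (R : ℝ) * S with hX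
  clear_value X
  have hDX : (D : ℝ) < X := hDX'
  have hX1 : 1 ≤ X := hD1.trans hDX.le
  have hX0 : 0 < X := by linarith
  set Y : ℝ := (D : ℝ) ^ (1 / 3 : ℝ) * X ^ (2 / 3 : ℝ) with hY
  clear_value Y
  have hY0 : 0 ≤ Y := by rw [hY]; positivity
  have hY2 : Y ^ 2 = D * H * X := by
    have h := Real.sq_sqrt (show (0 : ℝ) ≤ D * H * X by positivity)
    rw [hsqrt] at h
    exact h
  set a : ℝ := S / (H * R) with ha
  set b : ℝ := (S : ℝ) / R with hb
  clear_value a b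
  have ha0 : 0 < a := by rw [ha]; positivity
  have hab : a ≤ b := by
    rw [ha, hb, div_le_div_iff₀ (by positivity) hR0]
    nlinarith [mul_pos hS0 hR0]
  have hba : b / a = H := by rw [hb, ha]; field_simp
  have haR2 : a * (R : ℝ) ^ 2 = X / H := by rw [ha, hX]; field_simp
  have hbR2 : 24 * b * (R : ℝ) ^ 2 = 24 * R * S := by rw [hb]; field_simp
  obtain ⟨P, hP⟩ : ∃ P : ℝ, P = 2 * X / (5 * D * H) := ⟨_, rfl⟩
  have hP0 : 0 < P := by rw [hP]; positivity
  have hQ₁c : ∀ c : ℕ, 0 < c → 2 * a * (R : ℝ) ^ 2 / (5 * c * D) = P / c := by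
    intro c hc
    have hc0 : (0 : ℝ) < c := by exact_mod_cast hc
    rw [hP, mul_assoc 2 a, haR2]
    field_simp
  have hXP : X / Real.sqrt P ≤ 2 * Y := by
    have hsP : 0 < Real.sqrt P := Real.sqrt_pos.mpr hP0
    rw [div_le_iff₀ hsP]
    have h1 : (2 * Y * Real.sqrt P) ^ 2 = 4 * (D * H * X) * P := by
      rw [mul_pow, mul_pow, Real.sq_sqrt hP0.le, hY2]; ring
    have h2 : 4 * (D * H * X) * P = 8 / 5 * X ^ 2 := by rw [hP]; field_simp; ring
    calc X = Real.sqrt (X ^ 2) := (Real.sqrt_sq hX0.le).symm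
      _ ≤ Real.sqrt ((2 * Y * Real.sqrt P) ^ 2) := Real.sqrt_le_sqrt (by
          rw [h1, h2]; have : 0 ≤ X ^ 2 := sq_nonneg X; linarith)
      _ = 2 * Y * Real.sqrt P := Real.sqrt_sq (by positivity)
  obtain ⟨g, -, hg0, hg1, hg2, hga, hgb, hĜ⟩ := hcut a b ha0 hab
  set L : ℝ := 1 + Real.log (b / a) with hL
  clear_value L
  have hL𝓛 : L ≤ 3 * 𝓛 := by rw [hL, hba]; linarith
  have hL0 : 0 ≤ L := by rw [hL, hba]; linarith
  -- abbreviations for the norms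
  set Nβ : ℝ := ∑ r ∈ Ioc R (2 * R), ∑ s ∈ Ioc S (2 * S), ‖β r s‖ ^ 2 with hNβ
  set Tβ : ℝ := ∑ r ∈ Ioc R (2 * R), ∑ s ∈ Ioc S (2 * S), (σ 0 r : ℝ) * ‖β r s‖ ^ 2 with hTβ
  have hNβ0 : 0 ≤ Nβ := sum_nonneg fun _ _ => sum_nonneg fun _ _ => sq_nonneg _
  have hσ1 : ∀ r ∈ Ioc R (2 * R), (1 : ℝ) ≤ (σ 0 r : ℝ) := by
    intro r hr
    have hr0 : r ≠ 0 := by have := (mem_Ioc.mp hr).1; omega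
    rw [ArithmeticFunction.sigma_zero_apply]
    exact_mod_cast Finset.card_pos.mpr ⟨1, Nat.one_mem_divisors.mpr hr0⟩
  have hNT : Nβ ≤ Tβ := by
    refine sum_le_sum fun r hr => sum_le_sum fun s _ => ?_
    calc ‖β r s‖ ^ 2 = 1 * ‖β r s‖ ^ 2 := (one_mul _).symm
      _ ≤ (σ 0 r : ℝ) * ‖β r s‖ ^ 2 := mul_le_mul_of_nonneg_right (hσ1 r hr) (sq_nonneg _)
  have hTβ0 : 0 ≤ Tβ := hNβ0.trans hNT
  clear_value Nβ Tβ
  -- Step 3: the weights of the off-diagonal bound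
  set Nc : ℕ → ℝ := fun c => ∑ t ∈ Ioc (R / c) (2 * R / c), ∑ s ∈ Ioc S (2 * S),
    ‖β (c * t) s‖ ^ 2 with hNc
  set Tc : ℕ → ℝ := fun c => ∑ t ∈ Ioc (R / c) (2 * R / c), ∑ s ∈ Ioc S (2 * S),
    (σ 0 t : ℝ) * ‖β (c * t) s‖ ^ 2 with hTc
  have hNc0 : ∀ c, 0 ≤ Nc c := fun c => sum_nonneg fun _ _ => sum_nonneg fun _ _ => sq_nonneg _
  have hTc0 : ∀ c, 0 ≤ Tc c := fun c =>
    sum_nonneg fun _ _ => sum_nonneg fun _ _ => mul_nonneg (Nat.cast_nonneg _) (sq_nonneg _)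
  set T₀ : ℝ := 24 * (X ^ (3 / 2 : ℝ) / D) + 2 * (R * (S : ℝ) ^ (3 / 4 : ℝ)) +
    S * (R : ℝ) ^ (3 / 4 : ℝ) with hT₀
  clear_value T₀
  have hT₀0 : 0 ≤ T₀ := by rw [hT₀]; positivity
  have hKLI : 0 ≤ K * L ^ 2 * IM := by positivity
  set WN : ℝ := Cₒ * (8 * 𝓛) * (6 * 𝓛 * Y) * (K * L ^ 2 * IM) with hWN
  set WT : ℝ := Cₒ * (8 * 𝓛) * (T₀ * X ^ (ε / 4)) * (K * L ^ 2 * IM) with hWT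
  clear_value WN WT
  have hWN0 : 0 ≤ WN := by rw [hWN]; positivity
  have hWT0 : 0 ≤ WT := by rw [hWT]; positivity
  -- per-`(c, m)` bound of the off-diagonal coefficient
  have hBND : ∀ c ∈ Icc 1 R, ∀ m ∈ c.divisors,
      Cₒ * (1 + Real.log (max 1 (24 * b * (R : ℝ) ^ 2 / (c * D)))) *
        (((R : ℝ) / c * S / Real.sqrt ((m : ℝ) * (2 * a * (R : ℝ) ^ 2 / (5 * c * D))) *
              Real.log (2 * R) + (R : ℝ) / c * S / Real.sqrt (2 * a * (R : ℝ) ^ 2 / (5 * c * D))) *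
            Nc c +
          ((m : ℝ) * (max 1 (24 * b * (R : ℝ) ^ 2 / (c * D))) * Real.sqrt ((R : ℝ) / c * S) +
              (R : ℝ) / c * (S : ℝ) ^ (3 / 4 : ℝ) + (S : ℝ) * ((R : ℝ) / c) ^ (3 / 4 : ℝ)) *
            ((R : ℝ) / c * S) ^ (ε / 4) * Tc c) *
        (K * L ^ 2 * IM) ≤ WN / Real.sqrt c * Nc c + WT * Tc c := by
    intro c hc m hm
    have hc1 : 1 ≤ c := (mem_Icc.mp hc).1
    have hcR : c ≤ R := (mem_Icc.mp hc).2
    have hc0 : (0 : ℝ) < c := by exact_mod_cast hc1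
    have hc1r : (1 : ℝ) ≤ c := by exact_mod_cast hc1
    have hcRr : (c : ℝ) ≤ R := by exact_mod_cast hcR
    have hm1 : (1 : ℝ) ≤ m := by exact_mod_cast Nat.pos_of_mem_divisors hm
    have hmc : (m : ℝ) ≤ c := by exact_mod_cast Nat.divisor_le hm
    have hsc : 0 < Real.sqrt c := Real.sqrt_pos.mpr hc0
    -- (a) the logarithm
    have hlq : 1 + Real.log (max 1 (24 * b * (R : ℝ) ^ 2 / (c * D))) ≤ 8 * 𝓛 := by
      rw [hbR2]; exact hlogQ D c hD1 hc1r
    have hlq0 : 0 ≤ 1 + Real.log (max 1 (24 * b * (R : ℝ) ^ 2 / (c * D))) := by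
      have : 0 ≤ Real.log (max 1 (24 * b * (R : ℝ) ^ 2 / (c * D))) := Real.log_nonneg (le_max_left _ _)
      linarith only [this]
    -- (b) the `N`-coefficient
    have hXc : (R : ℝ) / c * S = X / c := by rw [hX]; ring
    have hb1 : (R : ℝ) / c * S / Real.sqrt (2 * a * (R : ℝ) ^ 2 / (5 * c * D)) ≤ 2 * Y / Real.sqrt c := by
      rw [hQ₁c c hc1, hXc, Real.sqrt_div' P hc0.le]  -- `√(P/c) = √P/√c`
      rw [div_div_eq_mul_div]
      have e : X / c * Real.sqrt c / Real.sqrt P = (X / Real.sqrt P) / Real.sqrt c := by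
        rw [div_mul_eq_mul_div, mul_div_assoc, Real.sqrt_div_self']
        ring
      rw [e]
      exact div_le_div_of_nonneg_right hXP hsc.le
    have hb2 : (R : ℝ) / c * S / Real.sqrt ((m : ℝ) * (2 * a * (R : ℝ) ^ 2 / (5 * c * D))) ≤
        2 * Y / Real.sqrt c := by
      refine le_trans ?_ hb1
      refine div_le_div_of_nonneg_left (by rw [hXc]; positivity) (Real.sqrt_pos.mpr (by
        rw [hQ₁c c hc1]; positivity)) ?_
      refine Real.sqrt_le_sqrt ?_
      have : 0 ≤ 2 * a * (R : ℝ) ^ 2 / (5 * c * D) := by positivity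
      exact le_mul_of_one_le_left this hm1
    have hT1 : (R : ℝ) / c * S / Real.sqrt ((m : ℝ) * (2 * a * (R : ℝ) ^ 2 / (5 * c * D))) *
        Real.log (2 * R) + (R : ℝ) / c * S / Real.sqrt (2 * a * (R : ℝ) ^ 2 / (5 * c * D)) ≤
        6 * 𝓛 * Y / Real.sqrt c := by
      have hl0 : 0 ≤ Real.log (2 * R) := Real.log_nonneg (by linarith only [hR1])
      have h2Y : 0 ≤ 2 * Y / Real.sqrt c := by positivity
      calc _ ≤ 2 * Y / Real.sqrt c * 𝓛 + 2 * Y / Real.sqrt c :=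
            add_le_add (mul_le_mul hb2 hlog2R hl0 h2Y) hb1
        _ = 2 * Y / Real.sqrt c * (𝓛 + 1) := by ring
        _ ≤ 2 * Y / Real.sqrt c * (3 * 𝓛) := mul_le_mul_of_nonneg_left (by linarith only [h12𝓛]) h2Y
        _ = 6 * 𝓛 * Y / Real.sqrt c := by ring
    -- (c) the `T`-coefficient
    have hmax : max 1 (24 * b * (R : ℝ) ^ 2 / (c * D)) ≤ 1 + 24 * X / (c * D) := by
      rw [hbR2]
      refine max_le (by
        have : 0 ≤ 24 * X / (c * D) := by positivity
        linarith only [this]) ?_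
      rw [hX, show 24 * (R : ℝ) * S / (c * D) = 24 * ((R : ℝ) * S) / (c * D) by ring]
      linarith only [show (0:ℝ) ≤ 1 by norm_num]
    have hsqX : Real.sqrt ((R : ℝ) / c * S) ≤ Real.sqrt X := by
      rw [hXc]; exact Real.sqrt_le_sqrt (div_le_self hX0.le hc1r)
    have hsqXc : (c : ℝ) * Real.sqrt ((R : ℝ) / c * S) ≤ R * (S : ℝ) ^ (3 / 4 : ℝ) := by
      -- `c √(X/c) = √(cX) ≤ √(R X) = R √S ≤ R S^{3/4}`
      rw [hXc]
      have e : (c : ℝ) * Real.sqrt (X / c) = Real.sqrt (c * X) := by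
        rw [show (c : ℝ) * X = (c : ℝ) ^ 2 * (X / c) by field_simp,
          Real.sqrt_mul (sq_nonneg _), Real.sqrt_sq hc0.le]
      rw [e]
      calc Real.sqrt (c * X) ≤ Real.sqrt (R * X) :=
            Real.sqrt_le_sqrt (mul_le_mul_of_nonneg_right hcRr hX0.le)
        _ = R * Real.sqrt S := by
            rw [hX, show (R : ℝ) * (R * S) = (R : ℝ) ^ 2 * S by ring, Real.sqrt_mul (sq_nonneg _),
              Real.sqrt_sq hR0.le]
        _ ≤ R * (S : ℝ) ^ (3 / 4 : ℝ) := by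
            refine mul_le_mul_of_nonneg_left ?_ hR0.le
            rw [Real.sqrt_eq_rpow]
            exact Real.rpow_le_rpow_of_exponent_le hS1 (by norm_num)
    have hT2a : (m : ℝ) * (max 1 (24 * b * (R : ℝ) ^ 2 / (c * D))) * Real.sqrt ((R : ℝ) / c * S) ≤
        R * (S : ℝ) ^ (3 / 4 : ℝ) + 24 * (X ^ (3 / 2 : ℝ) / D) := by
      have hs0 : 0 ≤ Real.sqrt ((R : ℝ) / c * S) := Real.sqrt_nonneg _
      calc (m : ℝ) * (max 1 (24 * b * (R : ℝ) ^ 2 / (c * D))) * Real.sqrt ((R : ℝ) / c * S)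
          ≤ (c : ℝ) * (1 + 24 * X / (c * D)) * Real.sqrt ((R : ℝ) / c * S) := by
            refine mul_le_mul_of_nonneg_right (mul_le_mul hmc hmax (le_trans zero_le_one
              (le_max_left _ _)) hc0.le) hs0
        _ = (c : ℝ) * Real.sqrt ((R : ℝ) / c * S) + 24 * X / D * Real.sqrt ((R : ℝ) / c * S) := by
            field_simp
        _ ≤ R * (S : ℝ) ^ (3 / 4 : ℝ) + 24 * X / D * Real.sqrt X :=
            add_le_add hsqXc (mul_le_mul_of_nonneg_left hsqX (by positivity))
        _ = R * (S : ℝ) ^ (3 / 4 : ℝ) + 24 * (X ^ (3 / 2 : ℝ) / D) := by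
            rw [Real.sqrt_eq_rpow, show (3 / 2 : ℝ) = 1 + 1 / 2 by norm_num,
              Real.rpow_add hX0, Real.rpow_one]
            ring
    have hT2b : (R : ℝ) / c * (S : ℝ) ^ (3 / 4 : ℝ) ≤ R * (S : ℝ) ^ (3 / 4 : ℝ) :=
      mul_le_mul_of_nonneg_right (div_le_self hR0.le hc1r) (by positivity)
    have hT2c : (S : ℝ) * ((R : ℝ) / c) ^ (3 / 4 : ℝ) ≤ S * (R : ℝ) ^ (3 / 4 : ℝ) :=
      mul_le_mul_of_nonneg_left (Real.rpow_le_rpow (by positivity) (div_le_self hR0.le hc1r)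
        (by norm_num)) hS0.le
    have hT2d : ((R : ℝ) / c * S) ^ (ε / 4) ≤ X ^ (ε / 4) := by
      rw [hXc]; exact Real.rpow_le_rpow (by positivity) (div_le_self hX0.le hc1r) (by positivity)
    have hT2 : ((m : ℝ) * (max 1 (24 * b * (R : ℝ) ^ 2 / (c * D))) * Real.sqrt ((R : ℝ) / c * S) +
        (R : ℝ) / c * (S : ℝ) ^ (3 / 4 : ℝ) + (S : ℝ) * ((R : ℝ) / c) ^ (3 / 4 : ℝ)) *
        ((R : ℝ) / c * S) ^ (ε / 4) ≤ T₀ * X ^ (ε / 4) := by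
      refine mul_le_mul ?_ hT2d (by positivity) hT₀0
      rw [hT₀]; linarith only [hT2a, hT2b, hT2c]
    -- collect
    have hNpart : Cₒ * (1 + Real.log (max 1 (24 * b * (R : ℝ) ^ 2 / (c * D)))) *
        (((R : ℝ) / c * S / Real.sqrt ((m : ℝ) * (2 * a * (R : ℝ) ^ 2 / (5 * c * D))) *
              Real.log (2 * R) + (R : ℝ) / c * S / Real.sqrt (2 * a * (R : ℝ) ^ 2 / (5 * c * D))) *
            Nc c) * (K * L ^ 2 * IM) ≤ WN / Real.sqrt c * Nc c := by
      have h1 : Cₒ * (1 + Real.log (max 1 (24 * b * (R : ℝ) ^ 2 / (c * D)))) ≤ Cₒ * (8 * 𝓛) :=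
        mul_le_mul_of_nonneg_left hlq hCₒ.le
      have hT10 : 0 ≤ (R : ℝ) / c * S / Real.sqrt ((m : ℝ) * (2 * a * (R : ℝ) ^ 2 / (5 * c * D))) *
          Real.log (2 * R) + (R : ℝ) / c * S / Real.sqrt (2 * a * (R : ℝ) ^ 2 / (5 * c * D)) := by
        have : 0 ≤ Real.log (2 * R) := Real.log_nonneg (by linarith only [hR1])
        positivity
      calc _ = Cₒ * (1 + Real.log (max 1 (24 * b * (R : ℝ) ^ 2 / (c * D)))) *
            (((R : ℝ) / c * S / Real.sqrt ((m : ℝ) * (2 * a * (R : ℝ) ^ 2 / (5 * c * D))) *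
              Real.log (2 * R) + (R : ℝ) / c * S / Real.sqrt (2 * a * (R : ℝ) ^ 2 / (5 * c * D))) *
            (K * L ^ 2 * IM)) * Nc c := by ring
        _ ≤ Cₒ * (8 * 𝓛) * (6 * 𝓛 * Y / Real.sqrt c * (K * L ^ 2 * IM)) * Nc c := by
            refine mul_le_mul_of_nonneg_right (mul_le_mul h1 (mul_le_mul_of_nonneg_right hT1 hKLI)
              (mul_nonneg hT10 hKLI) (by positivity)) (hNc0 c)
        _ = WN / Real.sqrt c * Nc c := by rw [hWN]; field_simp
    have hTpart : Cₒ * (1 + Real.log (max 1 (24 * b * (R : ℝ) ^ 2 / (c * D)))) *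
        (((m : ℝ) * (max 1 (24 * b * (R : ℝ) ^ 2 / (c * D))) * Real.sqrt ((R : ℝ) / c * S) +
              (R : ℝ) / c * (S : ℝ) ^ (3 / 4 : ℝ) + (S : ℝ) * ((R : ℝ) / c) ^ (3 / 4 : ℝ)) *
            ((R : ℝ) / c * S) ^ (ε / 4) * Tc c) * (K * L ^ 2 * IM) ≤ WT * Tc c := by
      have h1 : Cₒ * (1 + Real.log (max 1 (24 * b * (R : ℝ) ^ 2 / (c * D)))) ≤ Cₒ * (8 * 𝓛) :=
        mul_le_mul_of_nonneg_left hlq hCₒ.le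
      have hT20 : 0 ≤ ((m : ℝ) * (max 1 (24 * b * (R : ℝ) ^ 2 / (c * D))) * Real.sqrt ((R : ℝ) / c * S) +
          (R : ℝ) / c * (S : ℝ) ^ (3 / 4 : ℝ) + (S : ℝ) * ((R : ℝ) / c) ^ (3 / 4 : ℝ)) *
          ((R : ℝ) / c * S) ^ (ε / 4) := by
        have : 0 ≤ max 1 (24 * b * (R : ℝ) ^ 2 / (c * D)) := le_trans zero_le_one (le_max_left _ _)
        positivity
      calc _ = Cₒ * (1 + Real.log (max 1 (24 * b * (R : ℝ) ^ 2 / (c * D)))) *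
            ((((m : ℝ) * (max 1 (24 * b * (R : ℝ) ^ 2 / (c * D))) * Real.sqrt ((R : ℝ) / c * S) +
              (R : ℝ) / c * (S : ℝ) ^ (3 / 4 : ℝ) + (S : ℝ) * ((R : ℝ) / c) ^ (3 / 4 : ℝ)) *
              ((R : ℝ) / c * S) ^ (ε / 4)) * (K * L ^ 2 * IM)) * Tc c := by ring
        _ ≤ Cₒ * (8 * 𝓛) * (T₀ * X ^ (ε / 4) * (K * L ^ 2 * IM)) * Tc c := by
            refine mul_le_mul_of_nonneg_right (mul_le_mul h1 (mul_le_mul_of_nonneg_right hT2 hKLI)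
              (mul_nonneg hT20 hKLI) (by positivity)) (hTc0 c)
        _ = WT * Tc c := by rw [hWT]; ring
    calc _ = Cₒ * (1 + Real.log (max 1 (24 * b * (R : ℝ) ^ 2 / (c * D)))) *
          (((R : ℝ) / c * S / Real.sqrt ((m : ℝ) * (2 * a * (R : ℝ) ^ 2 / (5 * c * D))) *
                Real.log (2 * R) + (R : ℝ) / c * S / Real.sqrt (2 * a * (R : ℝ) ^ 2 / (5 * c * D))) *
              Nc c) * (K * L ^ 2 * IM) +
          Cₒ * (1 + Real.log (max 1 (24 * b * (R : ℝ) ^ 2 / (c * D)))) *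
          (((m : ℝ) * (max 1 (24 * b * (R : ℝ) ^ 2 / (c * D))) * Real.sqrt ((R : ℝ) / c * S) +
                (R : ℝ) / c * (S : ℝ) ^ (3 / 4 : ℝ) + (S : ℝ) * ((R : ℝ) / c) ^ (3 / 4 : ℝ)) *
              ((R : ℝ) / c * S) ^ (ε / 4) * Tc c) * (K * L ^ 2 * IM) := by ring
      _ ≤ _ := add_le_add hNpart hTpart
  -- summing the weights over `m ∣ c` and `c ≤ R`
  have hsumBND : ∑ c ∈ Icc 1 R, ∑ m ∈ c.divisors,
      Cₒ * (1 + Real.log (max 1 (24 * b * (R : ℝ) ^ 2 / (c * D)))) *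
        (((R : ℝ) / c * S / Real.sqrt ((m : ℝ) * (2 * a * (R : ℝ) ^ 2 / (5 * c * D))) *
              Real.log (2 * R) + (R : ℝ) / c * S / Real.sqrt (2 * a * (R : ℝ) ^ 2 / (5 * c * D))) *
            Nc c +
          ((m : ℝ) * (max 1 (24 * b * (R : ℝ) ^ 2 / (c * D))) * Real.sqrt ((R : ℝ) / c * S) +
              (R : ℝ) / c * (S : ℝ) ^ (3 / 4 : ℝ) + (S : ℝ) * ((R : ℝ) / c) ^ (3 / 4 : ℝ)) *
            ((R : ℝ) / c * S) ^ (ε / 4) * Tc c) *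
        (K * L ^ 2 * IM) ≤
      C₁ * WN * ∑ c ∈ Icc 1 R, Nc c + WT * ∑ c ∈ Icc 1 R, (σ 0 c : ℝ) * Tc c := by
    rw [mul_sum, mul_sum, ← sum_add_distrib]
    refine sum_le_sum fun c hc => ?_
    have hc1 : 1 ≤ c := (mem_Icc.mp hc).1
    have hc0 : (0 : ℝ) < c := by exact_mod_cast hc1
    have hτc : ((σ 0 c : ℕ) : ℝ) ≤ C₁ * Real.sqrt c := by
      rw [ArithmeticFunction.sigma_zero_apply, Real.sqrt_eq_rpow]
      exact hC₁ c (by omega)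
    calc ∑ m ∈ c.divisors, _ ≤ ∑ m ∈ c.divisors, (WN / Real.sqrt c * Nc c + WT * Tc c) :=
          sum_le_sum fun m hm => hBND c hc m hm
      _ = ((σ 0 c : ℕ) : ℝ) * (WN / Real.sqrt c * Nc c + WT * Tc c) := by
          rw [sum_const, nsmul_eq_mul, ArithmeticFunction.sigma_zero_apply]
      _ ≤ C₁ * Real.sqrt c * (WN / Real.sqrt c * Nc c) + ((σ 0 c : ℕ) : ℝ) * (WT * Tc c) := by
          rw [mul_add]
          have hpos : 0 ≤ WN / Real.sqrt c * Nc c := by positivity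
          exact add_le_add (mul_le_mul_of_nonneg_right hτc hpos) le_rfl
      _ = C₁ * WN * Nc c + WT * ((σ 0 c : ℝ) * Tc c) := by
          have e : C₁ * Real.sqrt c * (WN / Real.sqrt c * Nc c) = C₁ * WN * Nc c := by
            field_simp
          rw [e]
          ring
  -- re-indexing `r = ct`
  have hsumN : ∑ c ∈ Icc 1 R, Nc c ≤ Tβ := by
    have h := sum_Icc_sum_Ioc_div_le R (fun _ r => ∑ s ∈ Ioc S (2 * S), ‖β r s‖ ^ 2)
      (fun _ _ => sum_nonneg fun _ _ => sq_nonneg _)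
    refine (le_of_eq (by rfl)).trans (h.trans (le_of_eq ?_))
    rw [hTβ]
    refine sum_congr rfl fun r _ => ?_
    rw [sum_const, nsmul_eq_mul, ← ArithmeticFunction.sigma_zero_apply, mul_sum]
  have hsumT : ∑ c ∈ Icc 1 R, (σ 0 c : ℝ) * Tc c ≤ C₂ ^ 2 * (2 * X) ^ (ε / 10) * Tβ := by
    have h := sum_Icc_sum_Ioc_div_le R
      (fun c r => (σ 0 c : ℝ) * (σ 0 (r / c) : ℝ) * ∑ s ∈ Ioc S (2 * S), ‖β r s‖ ^ 2)
      (fun _ _ => mul_nonneg (mul_nonneg (Nat.cast_nonneg _) (Nat.cast_nonneg _))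
        (sum_nonneg fun _ _ => sq_nonneg _))
    have e1 : ∑ c ∈ Icc 1 R, (σ 0 c : ℝ) * Tc c = ∑ c ∈ Icc 1 R, ∑ t ∈ Ioc (R / c) (2 * R / c),
        (σ 0 c : ℝ) * (σ 0 (c * t / c) : ℝ) * ∑ s ∈ Ioc S (2 * S), ‖β (c * t) s‖ ^ 2 := by
      refine sum_congr rfl fun c hc => ?_
      have hc0 : 0 < c := (mem_Icc.mp hc).1
      rw [hTc]
      simp only
      rw [mul_sum]
      refine sum_congr rfl fun t _ => ?_
      rw [Nat.mul_div_cancel_left t hc0, mul_sum, mul_sum]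
      refine sum_congr rfl fun s _ => ?_
      ring
    rw [e1]
    refine h.trans ?_
    -- `∑_{c ∣ r} τ(c) τ(r/c) ≤ τ(r)³ ≤ C₂² (2X)^{ε/10} τ(r)`
    rw [hTβ, mul_sum]
    refine sum_le_sum fun r hr => ?_
    have hr1 : 1 ≤ r := by have := (mem_Ioc.mp hr).1; omega
    have hr0 : r ≠ 0 := by omega
    have hr2X : (r : ℝ) ≤ 2 * X := by
      have : ((r : ℕ) : ℝ) ≤ ((2 * R : ℕ) : ℝ) := by exact_mod_cast (mem_Ioc.mp hr).2
      push_cast at this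
      have h2 : (R : ℝ) ≤ R * S := by simpa using mul_le_mul_of_nonneg_left hS1 hR0.le
      rw [hX]; linarith only [this, h2]
    have hτr : ((σ 0 r : ℕ) : ℝ) ≤ C₂ * (2 * X) ^ (ε / 20) := by
      rw [ArithmeticFunction.sigma_zero_apply]
      refine (hC₂ r hr0).trans ?_
      exact mul_le_mul_of_nonneg_left (Real.rpow_le_rpow (Nat.cast_nonneg _) hr2X hδ.le)
        (zero_le_one.trans hC₂1)
    have hτr0 : (0 : ℝ) ≤ (σ 0 r : ℕ) := Nat.cast_nonneg _
    set Br : ℝ := ∑ s ∈ Ioc S (2 * S), ‖β r s‖ ^ 2 with hBr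
    have hBr0 : 0 ≤ Br := sum_nonneg fun _ _ => sq_nonneg _
    calc ∑ c ∈ r.divisors, (σ 0 c : ℝ) * (σ 0 (r / c) : ℝ) * Br
        ≤ ((σ 0 r : ℕ) : ℝ) * (((σ 0 r : ℕ) : ℝ) * ((σ 0 r : ℕ) : ℝ) * Br) := by
          refine sum_divisors_le_card_mul fun c hc => ?_
          have hcd : c ∣ r := Nat.dvd_of_mem_divisors hc
          refine mul_le_mul_of_nonneg_right ?_ hBr0
          refine mul_le_mul ?_ ?_ (Nat.cast_nonneg _) hτr0
          · rw [ArithmeticFunction.sigma_zero_apply, ArithmeticFunction.sigma_zero_apply]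
            exact_mod_cast card_le_card (Nat.divisors_subset_of_dvd hr0 hcd)
          · exact_mod_cast sigma_zero_div_le hr0 hcd
      _ = ((σ 0 r : ℕ) : ℝ) ^ 2 * (((σ 0 r : ℕ) : ℝ) * Br) := by ring
      _ ≤ (C₂ * (2 * X) ^ (ε / 20)) ^ 2 * (((σ 0 r : ℕ) : ℝ) * Br) := by
          exact mul_le_mul_of_nonneg_right (pow_le_pow_left₀ hτr0 hτr 2) (mul_nonneg hτr0 hBr0)
      _ = C₂ ^ 2 * ((2 * X) ^ (ε / 20)) ^ 2 * (((σ 0 r : ℕ) : ℝ) * Br) := by ring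
      _ = C₂ ^ 2 * (2 * X) ^ (ε / 10) * ∑ s ∈ Ioc S (2 * S), (σ 0 r : ℝ) * ‖β r s‖ ^ 2 := by
          have h2pow : ((2 * X) ^ (ε / 20)) ^ 2 = (2 * X) ^ (ε / 10) := by
            rw [← Real.rpow_natCast, ← Real.rpow_mul (by positivity)]
            congr 1
            push_cast
            ring
          rw [h2pow, hBr, mul_sum]
  -- Step 4: the explicit constants.  Powers of `X` and logarithms.
  have h2X : (2 * X) ^ (ε / 10) ≤ 2 * X ^ (ε / 10) := by
    rw [Real.mul_rpow (by norm_num) hX0.le]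
    refine mul_le_mul_of_nonneg_right ?_ (by positivity)
    calc (2 : ℝ) ^ (ε / 10) ≤ (2 : ℝ) ^ (1 : ℝ) :=
        Real.rpow_le_rpow_of_exponent_le (by norm_num) (by linarith only [hε1, hε])
      _ = 2 := Real.rpow_one 2
  have h𝓛pow : 𝓛 ≤ 20 / ε * (2 * X ^ (ε / 20)) := by
    have h1 : 𝓛 ≤ (2 * X) ^ (ε / 20) / (ε / 20) := by
      rw [h𝓛, show (2 : ℝ) * R * S = 2 * X by rw [hX]; ring]
      exact Real.log_le_rpow_div (by positivity) hδ
    have h2 : (2 * X) ^ (ε / 20) ≤ 2 * X ^ (ε / 20) := by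
      rw [Real.mul_rpow (by norm_num) hX0.le]
      refine mul_le_mul_of_nonneg_right ?_ (by positivity)
      calc (2 : ℝ) ^ (ε / 20) ≤ (2 : ℝ) ^ (1 : ℝ) :=
          Real.rpow_le_rpow_of_exponent_le (by norm_num) (by linarith only [hε1, hε])
        _ = 2 := Real.rpow_one 2
    rw [div_eq_mul_inv, show (ε / 20)⁻¹ = 20 / ε by rw [inv_div]] at h1
    calc 𝓛 ≤ (2 * X) ^ (ε / 20) * (20 / ε) := h1
      _ ≤ 2 * X ^ (ε / 20) * (20 / ε) := mul_le_mul_of_nonneg_right h2 (by positivity)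
      _ = _ := by ring
  have h𝓛ε2 : 𝓛 ≤ 2 / ε * (2 * X ^ (ε / 2)) := by
    have h1 : 𝓛 ≤ (2 * X) ^ (ε / 2) / (ε / 2) := by
      rw [h𝓛, show (2 : ℝ) * R * S = 2 * X by rw [hX]; ring]
      exact Real.log_le_rpow_div (by positivity) (by positivity)
    have h2 : (2 * X) ^ (ε / 2) ≤ 2 * X ^ (ε / 2) := by
      rw [Real.mul_rpow (by norm_num) hX0.le]
      refine mul_le_mul_of_nonneg_right ?_ (by positivity)
      calc (2 : ℝ) ^ (ε / 2) ≤ (2 : ℝ) ^ (1 : ℝ) :=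
          Real.rpow_le_rpow_of_exponent_le (by norm_num) (by linarith only [hε1, hε])
        _ = 2 := Real.rpow_one 2
    rw [div_eq_mul_inv, show (ε / 2)⁻¹ = 2 / ε by rw [inv_div]] at h1
    calc 𝓛 ≤ (2 * X) ^ (ε / 2) * (2 / ε) := h1
      _ ≤ 2 * X ^ (ε / 2) * (2 / ε) := mul_le_mul_of_nonneg_right h2 (by positivity)
      _ = _ := by ring
  -- products of powers of `X`
  have hXpow : X ^ (ε / 20) * X ^ (ε / 20) * X ^ (ε / 20) * X ^ (ε / 10) * X ^ (ε / 4) =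
      X ^ (ε / 2) := by
    rw [← Real.rpow_add hX0, ← Real.rpow_add hX0, ← Real.rpow_add hX0, ← Real.rpow_add hX0]
    ring_nf
  have hXe0 : 0 ≤ X ^ (ε / 2) := by positivity
  have hXe1 : 1 ≤ X ^ (ε / 2) := Real.one_le_rpow hX1 (by positivity)
  set TERM2 : ℝ := (D : ℝ)⁻¹ * X ^ (3 / 2 : ℝ) + R * (S : ℝ) ^ (3 / 4 : ℝ) + S * (R : ℝ) ^ (3 / 4 : ℝ)
    with hTERM2
  clear_value TERM2
  have hTERM20 : 0 ≤ TERM2 := by rw [hTERM2]; positivity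
  have hT₀le : T₀ ≤ 24 * TERM2 := by
    rw [hT₀, hTERM2, div_eq_mul_inv, mul_comm (X ^ (3 / 2 : ℝ))]
    have h₁ : 0 ≤ R * (S : ℝ) ^ (3 / 4 : ℝ) := by positivity
    have h₂ : 0 ≤ S * (R : ℝ) ^ (3 / 4 : ℝ) := by positivity
    have h₃ : 0 ≤ (D : ℝ)⁻¹ * X ^ (3 / 2 : ℝ) := by positivity
    linarith only [h₁, h₂, h₃]
  -- (γ) the `N`-part
  have hγ : C₁ * WN * Tβ ≤ cN * (Y * 𝓛 ^ 4) * Tβ := by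
    refine mul_le_mul_of_nonneg_right ?_ hTβ0
    rw [hWN, hcN]
    have hL2 : L ^ 2 ≤ (3 * 𝓛) ^ 2 := pow_le_pow_left₀ hL0 hL𝓛 2
    have h1 : C₁ * (Cₒ * (8 * 𝓛) * (6 * 𝓛 * Y) * (K * L ^ 2 * IM)) =
        (Cₒ * K * IM * C₁ * 48) * (𝓛 ^ 2 * Y) * L ^ 2 := by ring
    rw [h1]
    calc (Cₒ * K * IM * C₁ * 48) * (𝓛 ^ 2 * Y) * L ^ 2
        ≤ (Cₒ * K * IM * C₁ * 48) * (𝓛 ^ 2 * Y) * (3 * 𝓛) ^ 2 :=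
          mul_le_mul_of_nonneg_left hL2 (by positivity)
      _ = Cₒ * K * IM * C₁ * 432 * (Y * 𝓛 ^ 4) := by ring
      _ ≤ Cₒ * K * IM * C₁ * 3456 * (Y * 𝓛 ^ 4) := by
          have : 0 ≤ Cₒ * K * IM * C₁ * (Y * 𝓛 ^ 4) := by positivity
          linarith only [this]
  -- (δ) the `T`-part
  have hδ' : WT * (C₂ ^ 2 * (2 * X) ^ (ε / 10) * Tβ) ≤ cT * (TERM2 * X ^ (ε / 2)) * Tβ := by
    rw [← mul_assoc]
    refine mul_le_mul_of_nonneg_right ?_ hTβ0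
    rw [hWT, hcT]
    have hL2 : L ^ 2 ≤ (3 * 𝓛) ^ 2 := pow_le_pow_left₀ hL0 hL𝓛 2
    -- `𝓛³ ≤ (20/ε)³ 8 X^{3ε/20}`
    have h𝓛3 : 𝓛 ^ 3 ≤ (20 / ε) ^ 3 * 8 * (X ^ (ε / 20) * X ^ (ε / 20) * X ^ (ε / 20)) := by
      have := pow_le_pow_left₀ h𝓛0.le h𝓛pow 3
      calc 𝓛 ^ 3 ≤ (20 / ε * (2 * X ^ (ε / 20))) ^ 3 := this
        _ = _ := by ring
    calc Cₒ * (8 * 𝓛) * (T₀ * X ^ (ε / 4)) * (K * L ^ 2 * IM) * (C₂ ^ 2 * (2 * X) ^ (ε / 10))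
        ≤ Cₒ * (8 * 𝓛) * (24 * TERM2 * X ^ (ε / 4)) * (K * (3 * 𝓛) ^ 2 * IM) *
            (C₂ ^ 2 * (2 * X ^ (ε / 10))) := by
          gcongr
      _ = (Cₒ * K * IM * C₂ ^ 2 * 3456) * 𝓛 ^ 3 * (X ^ (ε / 10) * X ^ (ε / 4)) * TERM2 := by ring
      _ ≤ (Cₒ * K * IM * C₂ ^ 2 * 3456) * ((20 / ε) ^ 3 * 8 * (X ^ (ε / 20) * X ^ (ε / 20) *
            X ^ (ε / 20))) * (X ^ (ε / 10) * X ^ (ε / 4)) * TERM2 := by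
          gcongr
      _ = (Cₒ * K * IM * C₂ ^ 2 * (20 / ε) ^ 3 * 27648) *
            (TERM2 * (X ^ (ε / 20) * X ^ (ε / 20) * X ^ (ε / 20) * X ^ (ε / 10) * X ^ (ε / 4))) := by
          ring
      _ = (Cₒ * K * IM * C₂ ^ 2 * (20 / ε) ^ 3 * 27648) * (TERM2 * X ^ (ε / 2)) := by rw [hXpow]
  -- (ε) the coefficients of the diagonal part and of the excision
  have hceq : 3 * (D : ℝ) + 2 * ((S : ℝ) * (1 + Real.log (S : ℝ))) ≤
      3 * D + 48 / ε * (TERM2 * X ^ (ε / 2)) := by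
    -- `S(1 + log S) ≤ S · 3𝓛 ≤ S R^{3/4} · (12/ε) X^{ε/2} ≤ (12/ε) TERM2 X^{ε/2}`
    have h1 : 1 + Real.log S ≤ 3 * 𝓛 := by linarith only [hlogS, h12𝓛]
    have hSR : (S : ℝ) ≤ S * (R : ℝ) ^ (3 / 4 : ℝ) := by
      have : (1 : ℝ) ≤ (R : ℝ) ^ (3 / 4 : ℝ) := Real.one_le_rpow hR1 (by norm_num)
      exact le_mul_of_one_le_right hS0.le this
    have hST : (S : ℝ) ≤ TERM2 := by
      rw [hTERM2]
      have h₁ : 0 ≤ (D : ℝ)⁻¹ * X ^ (3 / 2 : ℝ) := by positivity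
      have h₂ : 0 ≤ R * (S : ℝ) ^ (3 / 4 : ℝ) := by positivity
      linarith only [h₁, h₂, hSR]
    have h2 : (S : ℝ) * (1 + Real.log S) ≤ TERM2 * (3 * 𝓛) :=
      mul_le_mul hST h1 (by linarith only [hlogS0]) hTERM20
    have h3 : TERM2 * (3 * 𝓛) ≤ TERM2 * (3 * (2 / ε * (2 * X ^ (ε / 2)))) :=
      mul_le_mul_of_nonneg_left (by linarith only [h𝓛ε2]) hTERM20
    have h4 : TERM2 * (3 * (2 / ε * (2 * X ^ (ε / 2)))) = 12 / ε * (TERM2 * X ^ (ε / 2)) := by ring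
    have h5 : 0 ≤ 12 / ε * (TERM2 * X ^ (ε / 2)) := by positivity
    have h6 : (S : ℝ) * (1 + Real.log S) ≤ 12 / ε * (TERM2 * X ^ (ε / 2)) :=
      h2.trans (h3.trans h4.le)
    have h7 := mul_le_mul_of_nonneg_left h6 (show (0 : ℝ) ≤ 2 by norm_num)
    have h8 : 2 * (12 / ε * (TERM2 * X ^ (ε / 2))) ≤ 48 / ε * (TERM2 * X ^ (ε / 2)) := by
      rw [show 2 * (12 / ε * (TERM2 * X ^ (ε / 2))) = 24 / ε * (TERM2 * X ^ (ε / 2)) by ring]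
      exact mul_le_mul_of_nonneg_right (div_le_div_of_nonneg_right (by norm_num) hε.le)
        (mul_nonneg hTERM20 hXe0)
    exact add_le_add le_rfl (h7.trans h8)
  have hEcoef : 3 * (D : ℝ) + (48 * a * (R : ℝ) ^ 2 * (1 + Real.log (1 + 16 * (R : ℝ) ^ 2 * a / D)) +
      3 * (16 * (R : ℝ) ^ 2 * a / D) * Real.sqrt (R * S)) ≤
      3 * D + 3456 * (Y * 𝓛 ^ 4) + 48 * (TERM2 * X ^ (ε / 2)) := by
    have e1 : 48 * a * (R : ℝ) ^ 2 = 48 * Y := by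
      rw [mul_assoc 48 a, haR2, ← hXH]
    have e2 : 16 * (R : ℝ) ^ 2 * a / D = 16 * H ^ 2 := by
      rw [show 16 * (R : ℝ) ^ 2 * a / D = 16 * (a * (R : ℝ) ^ 2) / D by ring, haR2, ← hXHD]
      field_simp
    rw [e1, e2, ← hX]
    -- the logarithm: `log(1 + 16H²) ≤ log(32 H²) = 5 log 2 + 2 log H ≤ 7𝓛`
    have hlog : Real.log (1 + 16 * H ^ 2) ≤ 7 * 𝓛 := by
      have hH21 : 1 ≤ H ^ 2 := one_le_pow₀ hH1
      have h1 : 1 + 16 * H ^ 2 ≤ 32 * H ^ 2 := by linarith only [hH21]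
      have h2 : Real.log (1 + 16 * H ^ 2) ≤ Real.log (32 * H ^ 2) :=
        Real.log_le_log (by positivity) h1
      have h3 : Real.log (32 * H ^ 2) = 5 * Real.log 2 + 2 * Real.log H := by
        rw [Real.log_mul (by norm_num) (by positivity), Real.log_pow,
          show (32 : ℝ) = 2 ^ 5 by norm_num, Real.log_pow]
        push_cast; ring
      linarith only [h2, h3, hlog2, hlogH]
    have hlog0 : 0 ≤ Real.log (1 + 16 * H ^ 2) := Real.log_nonneg (by linarith only [sq_nonneg H])
    -- `48 Y (1 + log(1+16H²)) ≤ 48 Y · 9𝓛 ≤ 432 Y 𝓛 (2𝓛)³ = 3456 Y 𝓛⁴`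
    have hA : 48 * Y * (1 + Real.log (1 + 16 * H ^ 2)) ≤ 3456 * (Y * 𝓛 ^ 4) := by
      have h1 : 1 + Real.log (1 + 16 * H ^ 2) ≤ 9 * 𝓛 := by linarith only [hlog, h12𝓛]
      have h2 : 48 * Y * (1 + Real.log (1 + 16 * H ^ 2)) ≤ 48 * Y * (9 * 𝓛) :=
        mul_le_mul_of_nonneg_left h1 (by positivity)
      have h3 : 𝓛 ≤ 𝓛 * (2 * 𝓛) ^ 3 := by
        have : 1 ≤ (2 * 𝓛) ^ 3 := one_le_pow₀ h12𝓛
        exact le_mul_of_one_le_right h𝓛0.le this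
      have h4 : 48 * Y * (9 * 𝓛) ≤ 48 * Y * (9 * (𝓛 * (2 * 𝓛) ^ 3)) :=
        mul_le_mul_of_nonneg_left (by linarith only [h3]) (by positivity)
      have h5 : 48 * Y * (9 * (𝓛 * (2 * 𝓛) ^ 3)) = 3456 * (Y * 𝓛 ^ 4) := by ring
      linarith only [h2, h4, h5]
    -- `3 · 16 H² √X = 48 H² √X ≤ 48 X^{3/2}/D ≤ 48 TERM2 ≤ 48 TERM2 X^{ε/2}`
    have hB : 3 * (16 * H ^ 2) * Real.sqrt X ≤ 48 * (TERM2 * X ^ (ε / 2)) := by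
      have h1 : H ^ 2 * Real.sqrt X ≤ TERM2 := by
        refine hH2.trans ?_
        rw [hTERM2, div_eq_mul_inv, mul_comm]
        have h₁ : 0 ≤ R * (S : ℝ) ^ (3 / 4 : ℝ) := by positivity
        have h₂ : 0 ≤ S * (R : ℝ) ^ (3 / 4 : ℝ) := by positivity
        linarith only [h₁, h₂]
      have h2 : TERM2 ≤ TERM2 * X ^ (ε / 2) := le_mul_of_one_le_right hTERM20 hXe1
      linarith only [h1, h2]
    linarith only [hA, hB]
  have h48 : (0 : ℝ) ≤ 48 / ε := by positivity
  have hc6 : (6 : ℝ) ≤ cN + cT + cE + 1 := by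
    have : (6 : ℝ) ≤ cE := by rw [hcE]; linarith only [h48]
    linarith only [this, hcN0, hcT0]
  have hcN' : cN + 3456 ≤ cN + cT + cE + 1 := by
    have : (3456 : ℝ) ≤ cE := by rw [hcE]; linarith only [h48]
    linarith only [this, hcT0]
  have hcT' : 48 / ε + cT + 48 ≤ cN + cT + cE + 1 := by
    have : 48 / ε + 48 ≤ cE := by rw [hcE]; linarith only [h48]
    linarith only [this, hcN0]
  -- Step 1: smoothing and excision
  set N : ℕ := 4 * R * S + 3 * D with hN
  clear_value N
  have hβcop : ∀ r s, β r s ≠ 0 → r.Coprime s := fun r s h =>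
    Nat.Coprime.coprime_dvd_right (dvd_mul_left s 2) (hβ r s h)
  have hg2' : ∀ x, 2 * a ≤ x → x ≤ 2 * S / R → g x = 1 := fun x h1 h2 =>
    hg2 x ⟨h1, by rw [hb]; linarith only [h2, show 2 * (S : ℝ) / R = 2 * ((S : ℝ) / R) by ring]⟩
  have hflip := jtVflip_le_smooth_excised (D := D) (R := R) (N := N) hS
    (by rw [hN]; exact le_add_left (by omega))
    β hβcop F hF0 hF1 hF2 hF3 hF4 g hg0 hg1 ha0 hg2'
  refine hflip.trans ?_
  rw [← hNβ]
  -- Step 2: split the main term into `r₁ = r₂` and `r₁ ≠ r₂`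
  have hMAIN : ∑ d ∈ Ioc 0 N, (F ((d : ℝ) / D) : ℂ) * ∑ r₁ ∈ Ioc R (2 * R), ∑ s₁ ∈ Ioc S (2 * S),
      ∑ r₂ ∈ Ioc R (2 * R), ∑ s₂ ∈ Ioc S (2 * S),
        (if (d : ℤ) ∣ (r₁ : ℤ) * s₂ - (r₂ : ℤ) * s₁ then
          β r₁ s₁ * conj (β r₂ s₂) * (J((d : ℤ) | r₁ * r₂) : ℂ) *
            (g |(s₁ : ℝ) / r₁ - (s₂ : ℝ) / r₂| : ℂ) else 0) =
      ∑ d ∈ Ioc 0 N, (F ((d : ℝ) / D) : ℂ) * ∑ r₁ ∈ Ioc R (2 * R), ∑ s₁ ∈ Ioc S (2 * S),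
        ∑ r₂ ∈ Ioc R (2 * R), ∑ s₂ ∈ Ioc S (2 * S),
        (if r₁ = r₂ ∧ (d : ℤ) ∣ (r₁ : ℤ) * s₂ - (r₂ : ℤ) * s₁ then
          β r₁ s₁ * conj (β r₂ s₂) * (J((d : ℤ) | r₁ * r₂) : ℂ) *
            (fun r₁ s₁ r₂ s₂ : ℕ => (g |(s₁ : ℝ) / r₁ - (s₂ : ℝ) / r₂| : ℂ)) r₁ s₁ r₂ s₂ else 0) +
      ∑ d ∈ Ioc 0 N, (F ((d : ℝ) / D) : ℂ) * ∑ r₁ ∈ Ioc R (2 * R), ∑ s₁ ∈ Ioc S (2 * S),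
        ∑ r₂ ∈ Ioc R (2 * R), ∑ s₂ ∈ Ioc S (2 * S),
        (if r₁ ≠ r₂ ∧ (d : ℤ) ∣ (r₁ : ℤ) * s₂ - (r₂ : ℤ) * s₁ then
          β r₁ s₁ * conj (β r₂ s₂) * (J((d : ℤ) | r₁ * r₂) : ℂ) *
            (g |(s₁ : ℝ) / r₁ - (s₂ : ℝ) / r₂| : ℂ) else 0) := by
    rw [← sum_add_distrib]
    refine sum_congr rfl fun d _ => ?_
    rw [← mul_add, ← sum_add_distrib]
    congr 1
    refine sum_congr rfl fun r₁ _ => ?_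
    rw [← sum_add_distrib]
    refine sum_congr rfl fun s₁ _ => ?_
    rw [← sum_add_distrib]
    refine sum_congr rfl fun r₂ _ => ?_
    rw [← sum_add_distrib]
    refine sum_congr rfl fun s₂ _ => ?_
    by_cases h : r₁ = r₂
    · simp [h]
    · simp [h]
  have heq := norm_sum_eqDenom_le (N := N) (D := D) (R := R) (S := S) β F hF0 hF1 hF3 hF4
    (fun r₁ s₁ r₂ s₂ : ℕ => (g |(s₁ : ℝ) / r₁ - (s₂ : ℝ) / r₂| : ℂ))
    (fun r₁ s₁ r₂ s₂ => by
      rw [Complex.norm_real, Real.norm_eq_abs, abs_le]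
      exact ⟨by linarith only [hg0 |(s₁ : ℝ) / r₁ - (s₂ : ℝ) / r₂|], hg1 _⟩)
  have hN4 : 4 * R * S ≤ N := by rw [hN]; exact Nat.le_add_right _ _
  have hN3 : 3 * D ≤ N := by rw [hN]; exact Nat.le_add_left _ _
  have hne := hoff R S D N β F M g a b K L hR hS hD hN4 hN3 hβ hβ4 hMc hMi hFM hF3 hF4 ha0 hga hgb
    hK.le hĜ
  rw [hMAIN]
  beta_reduce
  rw [← hIM] at hne
  rw [← hNβ] at heq
  clear hMAIN hflip
  have hne' := hne.trans (hsumBND.trans (add_le_add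
    (mul_le_mul_of_nonneg_left hsumN (by positivity)) (mul_le_mul_of_nonneg_left hsumT hWT0)))
  -- Step 5: collect everything (no `linarith` here: the context holds the huge forms)
  have hq0 : 0 ≤ 3 * (D : ℝ) + 48 / ε * (TERM2 * X ^ (ε / 2)) :=
    add_nonneg (by positivity) (mul_nonneg (by positivity) (mul_nonneg hTERM20 hXe0))
  have heq' := heq.trans (mul_le_mul hceq hNT hNβ0 hq0)
  have hne'' := hne'.trans (add_le_add hγ hδ')
  have hE' : (3 * (D : ℝ) + (48 * a * (R : ℝ) ^ 2 * (1 + Real.log (1 + 16 * (R : ℝ) ^ 2 * a / D)) +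
      3 * (16 * (R : ℝ) ^ 2 * a / D) * Real.sqrt (R * S))) * Nβ ≤
      (3 * D + 3456 * (Y * 𝓛 ^ 4) + 48 * (TERM2 * X ^ (ε / 2))) * Tβ :=
    mul_le_mul hEcoef hNT hNβ0 (add_nonneg (add_nonneg (by positivity)
      (mul_nonneg (by norm_num) (mul_nonneg hY0 (pow_nonneg h𝓛0.le 4))))
      (mul_nonneg (by norm_num) (mul_nonneg hTERM20 hXe0)))
  calc _ ≤ _ + _ := add_le_add (norm_add_le _ _) le_rfl
    _ ≤ (3 * (D : ℝ) + 48 / ε * (TERM2 * X ^ (ε / 2))) * Tβ +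
          (cN * (Y * 𝓛 ^ 4) * Tβ + cT * (TERM2 * X ^ (ε / 2)) * Tβ) +
          (3 * D + 3456 * (Y * 𝓛 ^ 4) + 48 * (TERM2 * X ^ (ε / 2))) * Tβ :=
        add_le_add (add_le_add heq' hne'') hE'
    _ = 6 * ((D : ℝ) * Tβ) + (cN + 3456) * (Y * 𝓛 ^ 4 * Tβ) +
          (48 / ε + cT + 48) * (TERM2 * X ^ (ε / 2) * Tβ) := by ring
    _ ≤ (cN + cT + cE + 1) * ((D : ℝ) * Tβ) + (cN + cT + cE + 1) * (Y * 𝓛 ^ 4 * Tβ) +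
          (cN + cT + cE + 1) * (TERM2 * X ^ (ε / 2) * Tβ) :=
        add_le_add (add_le_add (mul_le_mul_of_nonneg_right hc6 (mul_nonneg hD0.le hTβ0))
          (mul_le_mul_of_nonneg_right hcN' (mul_nonneg (mul_nonneg hY0 (pow_nonneg h𝓛0.le 4)) hTβ0)))
          (mul_le_mul_of_nonneg_right hcT' (mul_nonneg (mul_nonneg hTERM20 hXe0) hTβ0))
    _ = (cN + cT + cE + 1) * ((D : ℝ) + Y * 𝓛 ^ 4 + TERM2 * X ^ (ε / 2)) * Tβ := by ring

end Literature.NumberTheory.Sieve.FriedlanderIwaniecPrimes
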